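import Literature.AlgebraicGeometry.Frobenioids.ArchimedeanFSMIChainsN0
import HarnessLib

/-!
# Frobenioids II, Proposition 3.4 (viii) for `F₀ = R₀`: FSMI-morphisms lower the potential;
# condition (b) of "FSMFF-type" (2008 and 2024 forms) for the rigidified angloid `R₀`

Mochizuki, *The geometry of Frobenioids II: poly-Frobenioids*, Kyushu J. Math. **62** (2008)
401–460, §3, proof of Proposition 3.4 (viii), p. 32 ll. 5–30 [cite: MochizukiFrdII2008, Prop 3.4 (viii) p.32];
[FrdI] *Comments* (Jan 2024) (28): the revised condition (b) of "FSMFF-type".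

PROOF-ONLY file (abc-iut cell, layer L1, sub-DAG `SUBDAG-FrdII-Prop34.md` rows **P34-L10** /
**P34-L11** for `F₀ = R₀`, seat abc-iut-w5-d092; consumed BY NAME by row P34-L13, abc-iut-w5-d152).
The rigidified angloid `R₀ = (N₀)_A` (Ex. 3.3 (iv), abc-iut-L1-t6's `ArchFrd.R0 = Over N0.realUnit`)
is the slice of `N₀` over the real unit: every argument of `ArchimedeanFSMIChainsN0.lean` goes through
once the test arrows are equipped with structure maps (the forgetful functor `R₀ → N₀` reflects
isomorphisms; automorphisms / factorisations / sub-object tests are compatible with the structure maps):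

* `R0.isIso_of_isRealObj`, `R0.not_isFSMI_of_isComplex_of_isReal`, `R0.isComplexObj_of_isFSMI`,
  `R0.isIsotropic_of_isFSMI`, `R0.fsmiRank_lt_of_isFSMI`;
* `R0.isFSMIChain_le`, `R0.bounded_isFSMIChain` (2008 (b) for `R₀`), **`R0.bounded_headedFSMIChain`**
  (2024 (b) for `R₀`, bound `C0.fsmiRank + 1`).

HONEST SCOPE: only condition (b); nothing about condition (a) for the absolute `R₀` (cf. abc-iut-L1-d3's
FLAG #17 for `N`). [FrdII] §3 is classical and undisputed.
-/

namespace Literature.AlgebraicGeometry.Frobenioids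

open Set Function Topology Real CategoryTheory
open scoped Pointwise

noncomputable section

namespace ArchFrd

namespace R0

/-- The underlying `C₀`-object of an object of `R₀`. [cite: MochizukiFrdII2008, Ex 3.3 (iv) p.29] -/
abbrev carrier (X : R0) : C0 := X.left.carrier

variable {P Q : R0}

/-- An arrow of `R₀` whose `N₀`-component is an isomorphism is an isomorphism.
[cite: MochizukiFrdII2008, Ex 3.3 (iv) p.29] -/
theorem isIso_of_isIso_left (φ : P ⟶ Q) [IsIso φ.left] : IsIso φ := by
  haveI : IsIso ((Over.forget N0.realUnit).map φ) := by change IsIso φ.left; infer_instance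
  exact isIso_of_reflects_iso φ (Over.forget N0.realUnit)

/-- An arrow of `R₀` is an isomorphism iff its `N₀`-component is. [cite: MochizukiFrdII2008, Ex 3.3 (iv) p.29] -/
theorem isIso_iff_isIso_left (φ : P ⟶ Q) : IsIso φ ↔ IsIso φ.left :=
  ⟨fun _ => (inferInstance : IsIso ((Over.forget N0.realUnit).map φ)), fun _ => isIso_of_isIso_left φ⟩

/-- Real scalars are fixed by conjugation. [cite: MochizukiFrdII2008, Def 3.1 (ii) p.23] -/
theorem star_eq_of_mem_scalars_real {u : ℂˣ} (hu : u ∈ D0.scalars D0.real) : star u = u := by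
  have him : (u : ℂ).im = 0 := (D0.mem_scalars_real_iff u).1 hu
  ext
  change star (u : ℂ) = (u : ℂ)
  exact Complex.conj_eq_iff_im.2 him

/-! ### Real objects -/

/-- All arrows between real objects of `R₀` are isomorphisms. [cite: MochizukiFrdII2008, Ex 3.3 (iv) p.29] -/
theorem isIso_of_isRealObj (φ : P ⟶ Q) (hP : P.left.IsRealObj) (hQ : Q.left.IsRealObj) : IsIso φ := by
  haveI := N0.isIso_of_isRealObj φ.left hP hQ
  exact isIso_of_isIso_left φ

/-! ### No FSMI-morphism from a complex object to a real object -/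

/-- **No FSMI-morphism of `R₀` goes from a complex object to a real object.**
[cite: MochizukiFrdII2008, Prop 3.4 (viii) p.32] -/
theorem not_isFSMI_of_isComplex_of_isReal (φ : P ⟶ Q) (hP : (carrier P).IsComplexObj)
    (hQ : Q.left.IsRealObj) : ¬ IsFSMI φ := by
  rintro ⟨⟨-, hmono⟩, hnot, hirr⟩
  have hQreal : (carrier Q).base = D0.real := hQ
  by_cases hPi : (carrier P).region.IsIsotropic
  · -- isotropic source: the conjugation automorphism, compatible with the structure map
    obtain ⟨s, hs, hsd⟩ := C0.exists_conj_ratio (C0.scalar (N0.homCarrier φ.left))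
    have hρiso : PreFrobenioid.IsIsometry C0.toElem (C0.conjHom (carrier P) hP hPi s hs) := by
      rw [A0.isIsometry_iff_norm_mul_tip_pow]
      change ‖(s : ℂ)‖ * (carrier P).tip ^ ((1 : ℕ+) : ℕ) = (carrier P).tip
      rw [hs, one_mul, PNat.one_coe, pow_one]
    let ρN : P.left ⟶ P.left := N0.homMk (C0.conjHom (carrier P) hP hPi s hs) hρiso rfl
    have hρφ : ρN ≫ φ.left = φ.left := by
      apply N0.hom_ext
      rw [N0.homCarrier_comp, N0.homCarrier_homMk]
      refine C0.conjHom_comp hP hPi hs (N0.homCarrier φ.left) hQ ?_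
      rw [(N0.homCarrier_data φ.left).1]; exact hsd
    -- compatibility with the structure map `P.hom = φ.left ≫ Q.hom`
    have hw : ρN ≫ P.hom = P.hom := by
      rw [← Over.w φ, ← Category.assoc, hρφ]
    let ρ : P ⟶ P := Over.homMk ρN hw
    have hρ : ρ = 𝟙 P := hmono.right_cancellation _ _ (by
      rw [Category.id_comp]
      exact Over.OverMorphism.ext hρφ)
    have h1 : N0.homCarrier ρ.left = N0.homCarrier (𝟙 P : P ⟶ P).left := by rw [hρ]
    rw [Over.id_left, N0.homCarrier_id] at h1
    exact C0.conjHom_ne_id hP hPi hs h1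
  · -- non-isotropic source: factor through the isotropic hull
    have htiso : PreFrobenioid.IsIsometry C0.toElem (C0.toIsotropic (carrier P)) :=
      (A0.isIsometry_iff_ratio_eq_one _).2 (C0.ratio_toIsotropic _)
    have hliso : PreFrobenioid.IsIsometry C0.toElem (C0.liftIsotropify (N0.homCarrier φ.left) hQ) := by
      rw [A0.isIsometry_iff_norm_mul_tip_pow]
      exact (A0.isIsometry_iff_norm_mul_tip_pow (N0.homCarrier φ.left)).1 (N0.homCarrier_data φ.left).2
    let MN : N0 := ⟨⟨C0.isotropify (carrier P)⟩⟩
    let tN : P.left ⟶ MN := N0.homMk (C0.toIsotropic (carrier P)) htiso rfl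
    let lN : MN ⟶ Q.left :=
      N0.homMk (C0.liftIsotropify (N0.homCarrier φ.left) hQ) hliso (N0.homCarrier_data φ.left).1
    have hfacN : tN ≫ lN = φ.left := N0.hom_ext (by
      rw [N0.homCarrier_comp, N0.homCarrier_homMk, N0.homCarrier_homMk]
      exact C0.toIsotropic_comp_liftIsotropify _ hQ)
    let M : R0 := Over.mk (lN ≫ Q.hom)
    let t : P ⟶ M := Over.homMk tN (by
      change tN ≫ (lN ≫ Q.hom) = P.hom
      rw [← Category.assoc, hfacN, Over.w φ])
    let l : M ⟶ Q := Over.homMk lN rfl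
    have hfac : t ≫ l = φ := Over.OverMorphism.ext hfacN
    rcases hirr t l hfac with hl | ht
    · haveI : IsIso (N0.homCarrier l.left) :=
        (N0.isIso_iff_isIso_carrier _).1 ((isIso_iff_isIso_left l).1 hl)
      exact C0.not_isIso_of_complex_real (N0.homCarrier lN) hP hQ (by
        change IsIso (N0.homCarrier l.left); infer_instance)
    · haveI : IsIso (N0.homCarrier t.left) :=
        (N0.isIso_iff_isIso_carrier _).1 ((isIso_iff_isIso_left t).1 ht)
      exact C0.not_isIso_toIsotropic (carrier P) hPi (by
        change IsIso (N0.homCarrier t.left); infer_instance)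

/-- **Every FSMI-morphism of `R₀` has complex domain and codomain.** [cite: MochizukiFrdII2008, Prop 3.4 (viii) p.32] -/
theorem isComplexObj_of_isFSMI (φ : P ⟶ Q) (hφ : IsFSMI φ) :
    (carrier P).IsComplexObj ∧ (carrier Q).IsComplexObj := by
  rcases D0.isReal_or_isComplex (carrier P).base with hP | hP
  · exact absurd (isIso_of_isRealObj φ hP (N0.isRealObj_of_hom φ.left hP)) hφ.2.1
  rcases D0.isReal_or_isComplex (carrier Q).base with hQ | hQ
  · exact absurd hφ (not_isFSMI_of_isComplex_of_isReal φ hP hQ)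
  exact ⟨hP, hQ⟩

/-! ### FSMI-morphisms between complex objects -/

/-- **An FSMI-morphism of `R₀` has non-isotropic domain and isotropic codomain** (Lemma 3.2 (ix) via
sub-object tests equipped with the composite structure map). [cite: MochizukiFrdII2008, Prop 3.4 (viii) p.32] -/
theorem isIsotropic_of_isFSMI (φ : P ⟶ Q) (hφ : IsFSMI φ) :
    ¬ (carrier P).region.IsIsotropic ∧ (carrier Q).region.IsIsotropic := by
  obtain ⟨hP, hQ⟩ := isComplexObj_of_isFSMI φ hφ
  obtain ⟨⟨hfs, -⟩, hnot, -⟩ := hφ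
  have hnotc : ¬ IsIso (N0.homCarrier φ.left) := fun h =>
    hnot (by haveI := N0.isIso_of_isIso_carrier φ.left; exact isIso_of_isIso_left φ)
  haveI : IsIso (C0.Base (N0.homCarrier φ.left)) := D0.isIso_of_isComplex _ hP hQ
  constructor
  · intro hPi
    exact hnotc (C0.isIso_of_isIsotropic (N0.homCarrier φ.left) hPi (N0.homCarrier_data φ.left).1
      ((A0.isIsometry_iff_norm_mul_tip_pow _).1 (N0.homCarrier_data φ.left).2))
  · refine C0.isIsotropic_of_linear_lifts (N0.homCarrier φ.left) hP hQ (N0.homCarrier_data φ.left).1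
      (N0.homCarrier_data φ.left).2 hnotc ?_
    intro D hD hDo hDQ
    let ZN : N0 := ⟨⟨C0.subObj (carrier Q) hQ D hD hDo⟩⟩
    obtain ⟨-, hl, -, hi⟩ := C0.subHom_data (carrier Q) hQ hD hDo hDQ
    let γN : ZN ⟶ Q.left := N0.homMk (C0.subHom (carrier Q) hQ hD hDo hDQ) hi hl
    let Z : R0 := Over.mk (γN ≫ Q.hom)
    let γ : Z ⟶ Q := Over.homMk γN rfl
    obtain ⟨W, δP, δZ, hsq⟩ := hfs γ
    refine ⟨carrier W, N0.homCarrier δP.left, N0.homCarrier δZ.left, ?_⟩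
    have := congrArg (fun k : W ⟶ Q => N0.homCarrier k.left) hsq
    simp only [Over.comp_left, N0.homCarrier_comp] at this
    exact this

/-- **The FSMI-potential drops along every FSMI-morphism of `R₀`.** [cite: MochizukiFrdII2008, Prop 3.4 (viii) p.32] -/
theorem fsmiRank_lt_of_isFSMI (φ : P ⟶ Q) (hφ : IsFSMI φ) :
    (carrier Q).fsmiRank < (carrier P).fsmiRank := by
  obtain ⟨hP, -⟩ := isComplexObj_of_isFSMI φ hφ
  obtain ⟨hPi, hQi⟩ := isIsotropic_of_isFSMI φ hφ
  exact C0.fsmiRank_lt_of_isIsotropic hP hPi (Or.inr hQi)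

/-- The potential never increases along an arrow of `R₀`. [cite: MochizukiFrdII2008, Prop 3.4 (viii) p.32] -/
theorem fsmiRank_le_of_hom (φ : P ⟶ Q) : (carrier Q).fsmiRank ≤ (carrier P).fsmiRank :=
  C0.fsmiRank_le_of_hom (N0.homCarrier φ.left)

/-! ### Condition (b) of "FSMFF-type" for `R₀` -/

/-- A chain of `n` FSMI-morphisms out of `A` has `n ≤ C0.fsmiRank A`. [cite: MochizukiFrdII2008, Prop 3.4 (viii) p.32] -/
theorem isFSMIChain_le {A B : R0} {φ : A ⟶ B} {n : ℕ} (h : IsFSMIChain φ n) :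
    n ≤ (carrier A).fsmiRank := by
  induction h with
  | single φ hφ => exact Nat.one_le_of_lt (fsmiRank_lt_of_isFSMI φ hφ)
  | cons ψ χ n hψ _ ih => exact Nat.succ_le_of_lt (lt_of_le_of_lt ih (fsmiRank_lt_of_isFSMI ψ hψ))

/-- **Condition (b) of "FSMFF-type" (printed 2008 form) for `R₀`.** [cite: MochizukiFrdII2008, Prop 3.4 (viii) p.32] -/
theorem bounded_isFSMIChain (A : R0) :
    ∃ N : ℕ, ∀ {B : R0} (φ : A ⟶ B) (n : ℕ), IsFSMIChain φ n → n ≤ N :=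
  ⟨(carrier A).fsmiRank, fun _ _ h => isFSMIChain_le h⟩

/-- **Condition (b) of "FSMFF-type" (author's 2024 form: arbitrary head, FSMI tail) for `R₀`**, with
the bound `C0.fsmiRank A + 1` (print's "`N + 1`", p. 32 l. 30). [cite: MochizukiFrdII2008, Prop 3.4 (viii) p.32] -/
theorem bounded_headedFSMIChain (A : R0) :
    ∃ N : ℕ, ∀ {B : R0} (φ : A ⟶ B) (n : ℕ), IsHeadedFSMIChain ⊤ φ n → n ≤ N := by
  refine ⟨(carrier A).fsmiRank + 1, fun φ n h => ?_⟩
  cases h with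
  | single φ _ => exact Nat.succ_le_succ (Nat.zero_le _)
  | comp φ₁ χ m _ hχ =>
    exact Nat.succ_le_succ ((isFSMIChain_le hχ).trans (fsmiRank_le_of_hom φ₁))

end R0

end ArchFrd

end

end Literature.AlgebraicGeometry.Frobenioids
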